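import Literature.Analysis.FluidPDE.TaoCascadeModeDuhamel
import Literature.Analysis.FluidPDE.TaoAveragedRotDil

/-!
# Crux `PerpetualPump.AveragedTypeIBlowup` (stmt-NavierStokesRegularity-1835), line `Sketch`:
# stub `kernel` — the heat kernel `k_{i,n}(τ) = Re⟨e^{τΔ}ψ_{i,n}, ψ_{i,n}⟩` of a mode

T. Tao, *Finite time blowup for an averaged three-dimensional Navier–Stokes equation*, J. Amer.
Math. Soc. **29** (2016), 601–674 = arXiv:1402.0290v3, §4, proof of Lemma 4.1, p. 22, (4.14):
"Taking inner products of (4.14) with `ψ_{i,n}`, we have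
`u_{i,n}(t) = e^{tΔ} X_{i,n}(0) ψ_{i,n} + Σ … ∫₀ᵗ X X (t') e^{(t-t')Δ} ψ_{i,n} dt'`".
Pairing once more with `ψ_{i,n}` turns (4.14) into the exact Volterra chain of the coefficients,
`Y_{i,n}(t) = A δ k_{i,n}(t) + ∫₀ᵗ k_{i,n}(t-s) quadTerm(Y)_{i,n}(s) ds`, whose kernel is the heat kernel
of the mode, `k_{i,n}(τ) = Re⟨e^{τΔ}ψ_{i,n}, ψ_{i,n}⟩`. This file proves the registered stub
`stub_kernel` of the line's skeleton, verbatim: the kernel facts every analysis of the chain uses.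

On the Fourier side (Parseval, `ψ̂(-ξ) = \overline{ψ̂(ξ)}` for the real field `ψ_{i,n}`),
`⟨e^{τΔ}ψ_{i,n}, ψ_{i,n}⟩ = ∫ e^{-4π² max(τ,0)|ξ|²} |ψ̂_{i,n}(ξ)|² dξ`
(`pairing_heat_cascadeWavelet_self_eq_integral`; the weight `|ψ̂_{i,n}|²` is the accepted probability
density `modeWeight`, of total mass `‖ψ_{i,n}‖² = 1`, supported in the annulus
`(1+ε₀)ⁿ < |ξ| ≤ (1+ε₀)ⁿ(1+ε₀/2)`). Hence:

* `k_{i,n}(0) = 1`, `k_{i,n}` is real, continuous (dominated convergence) and non-increasing on `[0,∞)`;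
* `e^{-4π²(1+ε₀/2)²(1+ε₀)^{2n}τ} ≤ k_{i,n}(τ) ≤ e^{-4π²(1+ε₀)^{2n}τ}` for `τ ≥ 0` (the rate
  `4π²|ξ|²` is pinched on the annulus);
* the scaling law `k_{i,n}(τ) = k_{i,0}((1+ε₀)^{2n}τ)`, from the operator identities
  `e^{τΔ} Dil_c = Dil_c e^{c²τΔ}` (`heat_dil`, via the accepted `dil_fourierMultiplier`) and
  `⟨Dil_c u, Dil_c w⟩ = ⟨u, w⟩` (accepted `pairing_dil_dil`), since `ψ_{i,n} = Dil_{(1+ε₀)ⁿ} ψ_{i,0}`.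

Nothing here closes the item (`--supports`); no statement of the route changes.

## References

* T. Tao, J. Amer. Math. Soc. 29 (2016), 601–674, arXiv:1402.0290v3, §4 Lemma 4.1, p. 22
  ((4.14)); (1.11) for `Dil_λ`. [`Tao2016AveragedNS`]
-/

noncomputable section

-- the summit namespace `…NavierStokesRegularity.NavierStokesRegularity…` is the tree convention
set_option linter.dupNamespace false

open MeasureTheory Set Filter Topology
open scoped ENNReal
open Literature.Analysis.FluidPDE Literature.Analysis.FluidPDE.Tao2016
open Literature.Analysis.FluidPDE.TaoCascade (quadTerm IsSymmetricCoeff IsCancellingCoeff)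

namespace Summit.NavierStokesRegularity.NavierStokesRegularity.Theorems.PerpetualPumpAveragedTypeIBlowup

variable {ε₀ : ℝ} {m : ℕ}

/-! ### The heat kernel of a mode as a frequency integral -/

/-- The heat symbol through the heat rate, for every `τ`:
`e^{-4π² max(τ,0)|ξ|²} = e^{-λ(ξ) max(τ,0)}`, `λ(ξ) = 4π²|ξ|²`. [folklore] -/
theorem heatSymbol_eq_exp_heatRate_max (τ : ℝ) (ξ : EuclideanSpace ℝ (Fin 3)) :
    heatSymbol τ ξ = ((Real.exp (-(heatRate ξ * max τ 0)) : ℝ) : ℂ) := by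
  rw [heatSymbol, heatRate, show 4 * Real.pi ^ 2 * max τ 0 * ‖ξ‖ ^ 2 =
    4 * Real.pi ^ 2 * ‖ξ‖ ^ 2 * max τ 0 by ring]

/-- **The heat kernel of a mode as a frequency integral**:
`⟨e^{τΔ}ψ_{i,n}, ψ_{i,n}⟩ = ∫ e^{-λ(ξ) max(τ,0)} |ψ̂_{i,n}(ξ)|² dξ` (Parseval for the pairing, and
`ψ̂(-ξ) = \overline{ψ̂(ξ)}` for the real field `ψ_{i,n}`). [cite: Tao2016AveragedNS, §4 p. 22 (4.14)] -/
theorem pairing_heat_cascadeWavelet_self_eq_integral (𝒟 : CascadeWaveletData ε₀ m) (τ : ℝ) (i : Fin m)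
    (n : ℤ) :
    pairing (heat τ (cascadeWavelet ε₀ (𝒟.ψ i) n)) (cascadeWavelet ε₀ (𝒟.ψ i) n) =
      ((∫ ξ, Real.exp (-(heatRate ξ * max τ 0)) * modeWeight 𝒟 i n ξ : ℝ) : ℂ) := by
  rw [pairing_heat_eq_integral, ← integral_complex_ofReal]
  refine integral_congr_ae ?_
  filter_upwards [fourierFn_neg_eq_conj3 (isReal_cascadeWavelet ε₀ (𝒟.ψ i) n)] with ξ hξ
  rw [hξ, cdot_conj3_self, heatSymbol_eq_exp_heatRate_max, modeWeight]
  push_cast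
  ring

/-- Real-part form of `pairing_heat_cascadeWavelet_self_eq_integral`:
`k_{i,n}(τ) = ∫ e^{-λ(ξ) max(τ,0)} |ψ̂_{i,n}(ξ)|² dξ`. [cite: Tao2016AveragedNS, §4 p. 22 (4.14)] -/
theorem re_pairing_heat_cascadeWavelet_self (𝒟 : CascadeWaveletData ε₀ m) (τ : ℝ) (i : Fin m) (n : ℤ) :
    (pairing (heat τ (cascadeWavelet ε₀ (𝒟.ψ i) n)) (cascadeWavelet ε₀ (𝒟.ψ i) n)).re =
      ∫ ξ, Real.exp (-(heatRate ξ * max τ 0)) * modeWeight 𝒟 i n ξ := by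
  rw [pairing_heat_cascadeWavelet_self_eq_integral, Complex.ofReal_re]

/-- The damping factor `e^{-λ(ξ) max(τ,0)}` lies in `(0, 1]`. [folklore] -/
theorem exp_neg_heatRate_mul_max_le_one (τ : ℝ) (ξ : EuclideanSpace ℝ (Fin 3)) :
    Real.exp (-(heatRate ξ * max τ 0)) ≤ 1 := by
  rw [Real.exp_le_one_iff, neg_nonpos]
  exact mul_nonneg (heatRate_nonneg ξ) (le_max_right τ 0)

/-- The kernel integrand `e^{-λ(ξ) max(τ,0)} |ψ̂_{i,n}(ξ)|²` is integrable (bounded factor times the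
integrable weight). [folklore] -/
theorem integrable_exp_mul_modeWeight (𝒟 : CascadeWaveletData ε₀ m) (i : Fin m) (n : ℤ) (τ : ℝ) :
    Integrable (fun ξ : EuclideanSpace ℝ (Fin 3) =>
      Real.exp (-(heatRate ξ * max τ 0)) * modeWeight 𝒟 i n ξ) := by
  refine (integrable_modeWeight (𝒟 := 𝒟) (i := i) (n := n)).bdd_mul (c := 1)
    (Real.continuous_exp.comp ((continuous_heatRate.mul continuous_const).neg)).aestronglyMeasurable
    (Eventually.of_forall fun ξ => ?_)
  rw [Real.norm_eq_abs, Real.abs_exp]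
  exact exp_neg_heatRate_mul_max_le_one τ ξ

/-- Off the frequency region of the mode the weight `|ψ̂_{i,n}|²` vanishes (a.e.). [cite: Tao2016AveragedNS, §4 Lemma 4.1] -/
theorem modeWeight_eq_zero_of_not_mem (hε : 0 < 1 + ε₀) (𝒟 : CascadeWaveletData ε₀ m) (i : Fin m) (n : ℤ) :
    ∀ᵐ ξ ∂(volume : Measure (EuclideanSpace ℝ (Fin 3))), ξ ∉ freqRegion 𝒟 i n → modeWeight 𝒟 i n ξ = 0 := by
  filter_upwards [𝒟.fourierFn_cascadeWavelet_eq_zero hε i n] with ξ hξ h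
  simp [modeWeight, hξ h]

/-- On the frequency region of the mode the heat rate is pinched:
`4π²(1+ε₀)^{2n} ≤ λ(ξ) ≤ 4π²(1+ε₀/2)²(1+ε₀)^{2n}`. [cite: Tao2016AveragedNS, §4 Lemma 4.1] -/
theorem heatRate_mem_freqRegion (hε : 0 < 1 + ε₀) (𝒟 : CascadeWaveletData ε₀ m) (i : Fin m) (n : ℤ)
    {ξ : EuclideanSpace ℝ (Fin 3)} (h : ξ ∈ freqRegion 𝒟 i n) :
    4 * Real.pi ^ 2 * (1 + ε₀) ^ (2 * n) ≤ heatRate ξ ∧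
      heatRate ξ ≤ 4 * Real.pi ^ 2 * (1 + ε₀ / 2) ^ 2 * (1 + ε₀) ^ (2 * n) := by
  obtain ⟨h1, h2⟩ := 𝒟.norm_of_mem_freqRegion hε i n h
  have hc : 0 < (1 + ε₀) ^ n := zpow_pos hε n
  have hsq : (1 + ε₀) ^ (2 * n) = ((1 + ε₀) ^ n) ^ 2 := by rw [zpow_mul', zpow_ofNat]
  rw [heatRate, hsq]
  refine ⟨mul_le_mul_of_nonneg_left (pow_le_pow_left₀ hc.le h1.le 2) (by positivity), ?_⟩
  calc 4 * Real.pi ^ 2 * ‖ξ‖ ^ 2 ≤ 4 * Real.pi ^ 2 * ((1 + ε₀) ^ n * (1 + ε₀ / 2)) ^ 2 :=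
        mul_le_mul_of_nonneg_left (pow_le_pow_left₀ (norm_nonneg _) h2 2) (by positivity)
    _ = 4 * Real.pi ^ 2 * (1 + ε₀ / 2) ^ 2 * ((1 + ε₀) ^ n) ^ 2 := by ring

/-! ### Heat flow and dilations -/

/-- The heat symbol is dilation covariant: `e^{-4π² max(c²τ,0)|ξ/c|²} = e^{-4π² max(τ,0)|ξ|²}`
(`c > 0`). [folklore] -/
theorem heatSymbol_sq_mul_inv_smul {c : ℝ} (hc : 0 < c) (τ : ℝ) (ξ : EuclideanSpace ℝ (Fin 3)) :
    heatSymbol (c ^ 2 * τ) (c⁻¹ • ξ) = heatSymbol τ ξ := by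
  have hmax : max (c ^ 2 * τ) 0 = c ^ 2 * max τ 0 := by
    rw [mul_max_of_nonneg τ 0 (sq_nonneg c), mul_zero]
  have hc' : c ≠ 0 := hc.ne'
  have h : 4 * Real.pi ^ 2 * max (c ^ 2 * τ) 0 * (c⁻¹ * ‖ξ‖) ^ 2 =
      4 * Real.pi ^ 2 * max τ 0 * ‖ξ‖ ^ 2 := by
    rw [hmax]
    field_simp
  rw [heatSymbol, heatSymbol, norm_smul, norm_inv, Real.norm_of_nonneg hc.le, h]

/-- **Heat flow and dilation commute up to rescaling time**: `e^{τΔ} Dil_c = Dil_c e^{c²τΔ}`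
(`c > 0`; the symbol of `e^{τΔ}` at `ξ` is that of `e^{c²τΔ}` at `ξ/c`, and dilations normalise the
multipliers, accepted `dil_fourierMultiplier`). [cite: Tao2016AveragedNS, (1.11)] -/
theorem heat_dil {c : ℝ} (hc : 0 < c) (τ : ℝ) (f : L2C) :
    heat τ (dil c f) = dil c (heat (c ^ 2 * τ) f) := by
  have hfun : (fun ξ : EuclideanSpace ℝ (Fin 3) => heatSymbol (c ^ 2 * τ) (c⁻¹ • ξ)) = heatSymbol τ :=
    funext fun ξ => heatSymbol_sq_mul_inv_smul hc τ ξ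
  have hmc : MemLp (fun ξ : EuclideanSpace ℝ (Fin 3) => heatSymbol (c ^ 2 * τ) (c⁻¹ • ξ)) ∞
      (volume : Measure (EuclideanSpace ℝ (Fin 3))) := by
    rw [hfun]
    exact memLp_top_heatSymbol τ
  unfold heat
  rw [dil_fourierMultiplier hc (memLp_top_heatSymbol (c ^ 2 * τ)) hmc f]
  congr 1
  exact (MemLp.toLp_congr hmc (memLp_top_heatSymbol τ) (Eventually.of_forall fun ξ => congrFun hfun ξ)).symm

/-- **Scaling law of the heat kernel of the wavelets**:
`⟨e^{τΔ}ψ_n, ψ_n⟩ = ⟨e^{(1+ε₀)^{2n}τΔ}ψ_0, ψ_0⟩` (`ψ_n = Dil_{(1+ε₀)ⁿ} ψ_0`, `heat_dil`, and the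
dilation invariance of the pairing). [cite: Tao2016AveragedNS, (1.11)] -/
theorem pairing_heat_cascadeWavelet_self_scaling (hε : 0 < 1 + ε₀)
    (ψ : SchwartzMap (EuclideanSpace ℝ (Fin 3)) (EuclideanSpace ℝ (Fin 3))) (τ : ℝ) (n : ℤ) :
    pairing (heat τ (cascadeWavelet ε₀ ψ n)) (cascadeWavelet ε₀ ψ n) =
      pairing (heat ((1 + ε₀) ^ (2 * n) * τ) (cascadeWavelet ε₀ ψ 0)) (cascadeWavelet ε₀ ψ 0) := by
  have hc : 0 < (1 + ε₀) ^ n := zpow_pos hε n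
  have h0 : cascadeWavelet ε₀ ψ 0 = schwartzL2 ψ := by
    rw [cascadeWavelet, zpow_zero, dil_one]
  have hsq : (1 + ε₀) ^ (2 * n) = ((1 + ε₀) ^ n) ^ 2 := by rw [zpow_mul', zpow_ofNat]
  rw [h0, hsq, cascadeWavelet, heat_dil hc, pairing_dil_dil hc]

/-! ### The registered stub -/

/-- **Registered stub `stub_kernel`: the heat kernel of a mode.** For `0 < ε₀ ≤ 1`, wavelet data `𝒟`
and a mode `(i,n)`, the kernel `k_{i,n}(τ) = Re⟨e^{τΔ}ψ_{i,n}, ψ_{i,n}⟩` of the exact Volterra chain of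
the wavelet coefficients obeys: `k_{i,n}(0) = 1`; for `τ ≥ 0`,
`e^{-4π²(1+ε₀/2)²(1+ε₀)^{2n}τ} ≤ k_{i,n}(τ) ≤ e^{-4π²(1+ε₀)^{2n}τ}` (`ψ̂_{i,n}` lives where
`(1+ε₀)ⁿ < |ξ| ≤ (1+ε₀)ⁿ(1+ε₀/2)` and `‖ψ_{i,n}‖ = 1`); `⟨e^{τΔ}ψ_{i,n}, ψ_{i,n}⟩` is real; `k_{i,n}` is
continuous and non-increasing on `[0,∞)`; and the scaling law `k_{i,n}(τ) = k_{i,0}((1+ε₀)^{2n}τ)`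
("taking inner products of (4.14) with `ψ_{i,n}`", p. 22, on the Fourier side
`k_{i,n}(τ) = ∫ e^{-4π²τ|ξ|²}|ψ̂_{i,n}(ξ)|² dξ`). [cite: Tao2016AveragedNS, §4 p. 22 (4.14)] -/
theorem stub_kernel :
    ∀ {ε₀ : ℝ}, 0 < ε₀ → ε₀ ≤ 1 → ∀ {m : ℕ} (𝒟 : CascadeWaveletData ε₀ m) (i : Fin m) (n : ℤ),
      (pairing (heat 0 (cascadeWavelet ε₀ (𝒟.ψ i) n)) (cascadeWavelet ε₀ (𝒟.ψ i) n)).re = 1 ∧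
      (∀ τ : ℝ, 0 ≤ τ →
        Real.exp (-(4 * Real.pi ^ 2 * (1 + ε₀ / 2) ^ 2 * (1 + ε₀) ^ (2 * n) * τ)) ≤
          (pairing (heat τ (cascadeWavelet ε₀ (𝒟.ψ i) n)) (cascadeWavelet ε₀ (𝒟.ψ i) n)).re ∧
        (pairing (heat τ (cascadeWavelet ε₀ (𝒟.ψ i) n)) (cascadeWavelet ε₀ (𝒟.ψ i) n)).re ≤
          Real.exp (-(4 * Real.pi ^ 2 * (1 + ε₀) ^ (2 * n) * τ))) ∧
      (∀ τ : ℝ, (pairing (heat τ (cascadeWavelet ε₀ (𝒟.ψ i) n)) (cascadeWavelet ε₀ (𝒟.ψ i) n)).im = 0) ∧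
      Continuous (fun τ : ℝ => (pairing (heat τ (cascadeWavelet ε₀ (𝒟.ψ i) n)) (cascadeWavelet ε₀ (𝒟.ψ i) n)).re) ∧
      AntitoneOn (fun τ : ℝ => (pairing (heat τ (cascadeWavelet ε₀ (𝒟.ψ i) n)) (cascadeWavelet ε₀ (𝒟.ψ i) n)).re)
        (Ici 0) ∧
      (∀ τ : ℝ, 0 ≤ τ → (pairing (heat τ (cascadeWavelet ε₀ (𝒟.ψ i) n)) (cascadeWavelet ε₀ (𝒟.ψ i) n)).re =
        (pairing (heat ((1 + ε₀) ^ (2 * n) * τ) (cascadeWavelet ε₀ (𝒟.ψ i) 0)) (cascadeWavelet ε₀ (𝒟.ψ i) 0)).re) := by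
  intro ε₀ hε₀ _ m 𝒟 i n
  have hε : 0 < 1 + ε₀ := by linarith
  refine ⟨?_, fun τ hτ => ⟨?_, ?_⟩, fun τ => ?_, ?_, fun a _ b _ hab => ?_, fun τ _ => ?_⟩
  · -- value at `τ = 0`
    rw [heat_zero, 𝒟.pairing_cascadeWavelet_self hε, Complex.one_re]
  · -- lower bound
    calc Real.exp (-(4 * Real.pi ^ 2 * (1 + ε₀ / 2) ^ 2 * (1 + ε₀) ^ (2 * n) * τ))
        = ∫ ξ, Real.exp (-(4 * Real.pi ^ 2 * (1 + ε₀ / 2) ^ 2 * (1 + ε₀) ^ (2 * n) * τ)) *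
            modeWeight 𝒟 i n ξ := by
          rw [integral_const_mul, integral_modeWeight hε, mul_one]
      _ ≤ ∫ ξ, Real.exp (-(heatRate ξ * max τ 0)) * modeWeight 𝒟 i n ξ := by
          refine integral_mono_ae (integrable_modeWeight.const_mul _)
            (integrable_exp_mul_modeWeight 𝒟 i n τ) ?_
          filter_upwards [modeWeight_eq_zero_of_not_mem hε 𝒟 i n] with ξ hξ
          by_cases hmem : ξ ∈ freqRegion 𝒟 i n
          · refine mul_le_mul_of_nonneg_right ?_ (modeWeight_nonneg ξ)
            rw [max_eq_left hτ, Real.exp_le_exp, neg_le_neg_iff]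
            exact mul_le_mul_of_nonneg_right (heatRate_mem_freqRegion hε 𝒟 i n hmem).2 hτ
          · simp only [hξ hmem, mul_zero, le_refl]
      _ = (pairing (heat τ (cascadeWavelet ε₀ (𝒟.ψ i) n)) (cascadeWavelet ε₀ (𝒟.ψ i) n)).re :=
          (re_pairing_heat_cascadeWavelet_self 𝒟 τ i n).symm
  · -- upper bound
    calc (pairing (heat τ (cascadeWavelet ε₀ (𝒟.ψ i) n)) (cascadeWavelet ε₀ (𝒟.ψ i) n)).re
        = ∫ ξ, Real.exp (-(heatRate ξ * max τ 0)) * modeWeight 𝒟 i n ξ :=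
          re_pairing_heat_cascadeWavelet_self 𝒟 τ i n
      _ ≤ ∫ ξ, Real.exp (-(4 * Real.pi ^ 2 * (1 + ε₀) ^ (2 * n) * τ)) * modeWeight 𝒟 i n ξ := by
          refine integral_mono_ae (integrable_exp_mul_modeWeight 𝒟 i n τ)
            (integrable_modeWeight.const_mul _) ?_
          filter_upwards [modeWeight_eq_zero_of_not_mem hε 𝒟 i n] with ξ hξ
          by_cases hmem : ξ ∈ freqRegion 𝒟 i n
          · refine mul_le_mul_of_nonneg_right ?_ (modeWeight_nonneg ξ)
            rw [max_eq_left hτ, Real.exp_le_exp, neg_le_neg_iff]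
            exact mul_le_mul_of_nonneg_right (heatRate_mem_freqRegion hε 𝒟 i n hmem).1 hτ
          · simp only [hξ hmem, mul_zero, le_refl]
      _ = Real.exp (-(4 * Real.pi ^ 2 * (1 + ε₀) ^ (2 * n) * τ)) := by
          rw [integral_const_mul, integral_modeWeight hε, mul_one]
  · -- realness
    exact pairing_im ((isReal_cascadeWavelet ε₀ (𝒟.ψ i) n).heat τ) (isReal_cascadeWavelet ε₀ (𝒟.ψ i) n)
  · -- continuity (dominated convergence, dominating function `|ψ̂_{i,n}|²`)
    have hk : (fun τ : ℝ => (pairing (heat τ (cascadeWavelet ε₀ (𝒟.ψ i) n)) (cascadeWavelet ε₀ (𝒟.ψ i) n)).re) =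
        fun τ => ∫ ξ, Real.exp (-(heatRate ξ * max τ 0)) * modeWeight 𝒟 i n ξ :=
      funext fun τ => re_pairing_heat_cascadeWavelet_self 𝒟 τ i n
    rw [hk]
    refine continuous_of_dominated (bound := modeWeight 𝒟 i n)
      (fun τ => (integrable_exp_mul_modeWeight 𝒟 i n τ).aestronglyMeasurable)
      (fun τ => Eventually.of_forall fun ξ => ?_) integrable_modeWeight
      (Eventually.of_forall fun ξ => ?_)
    · rw [Real.norm_eq_abs, abs_mul, Real.abs_exp, abs_of_nonneg (modeWeight_nonneg ξ)]
      exact mul_le_of_le_one_left (modeWeight_nonneg ξ) (exp_neg_heatRate_mul_max_le_one τ ξ)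
    · exact (Real.continuous_exp.comp
        ((continuous_const.mul (continuous_id.max continuous_const)).neg)).mul continuous_const
  · -- monotonicity
    show (pairing (heat b (cascadeWavelet ε₀ (𝒟.ψ i) n)) (cascadeWavelet ε₀ (𝒟.ψ i) n)).re ≤
      (pairing (heat a (cascadeWavelet ε₀ (𝒟.ψ i) n)) (cascadeWavelet ε₀ (𝒟.ψ i) n)).re
    rw [re_pairing_heat_cascadeWavelet_self, re_pairing_heat_cascadeWavelet_self]
    refine integral_mono_ae (integrable_exp_mul_modeWeight 𝒟 i n b)
      (integrable_exp_mul_modeWeight 𝒟 i n a) (Eventually.of_forall fun ξ => ?_)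
    refine mul_le_mul_of_nonneg_right (Real.exp_le_exp.2 (neg_le_neg ?_)) (modeWeight_nonneg ξ)
    exact mul_le_mul_of_nonneg_left (max_le_max hab le_rfl) (heatRate_nonneg ξ)
  · -- scaling
    rw [pairing_heat_cascadeWavelet_self_scaling hε (𝒟.ψ i) τ n]

end Summit.NavierStokesRegularity.NavierStokesRegularity.Theorems.PerpetualPumpAveragedTypeIBlowup
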